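import Summits.BirchSwinnertonDyer.BirchSwinnertonDyer.Theses.GenusKolyvaginAtTwo
import Summits.BirchSwinnertonDyer.BirchSwinnertonDyer.Theorems.GenusKolyvaginAtTwoPowDvdShaCardAtTwoRTGenusParity
import Literature.NumberTheory.EllipticCurves.Greenberg1999.TwoTorsionDiscriminantConfigurationProofs
import HarnessLib

/-!
# Route `GenusKolyvaginAtTwo`: the rank-one input U₂ `MinimalTwinBSDTwo` (stmt-BirchSwinnertonDyer-22985) IS CONSUMED BY `closes`
# ON EXACTLY TWO TAMAGAWA CELLS — `(Δ > 0, ord₂ C = 0)` and `(Δ < 0, ord₂ C = 1)` — and LINE 23's odd-Tamagawa slice is the first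

Seat `bsd-line-gk2-p3` g28 (PROVER seat 3/3, cell `bsd-f1-sign2`), `--supports stmt-BirchSwinnertonDyer-22985` (helper; closes nothing).
THEOREMS ONLY (no definition, no named fact, no `sorry`); standard axioms.  **BSD is NOT proved by this file; U₂ is NOT proved; no item is
closed.**  The main theorem is CONDITIONAL on the route's items exactly like the deciding theorem `closes` (rev 53) — it is that theorem with
ONE binder weakened, i.e. a bookkeeping statement about what the route consumes.

WHY.  In `closes` the binder `hTw : MinimalTwinBSDTwo` (`BSD₂` for EVERY non-CM `W` of analytic rank `1` with `#Sel₂(W) = 2`) is applied only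
to the twin `Wd ≅ E^(d_K)` delivered by the two supply cruxes: on the `Δ_E < 0` branch with `ord₂ C(Wd) ≤ 1` (`GenusDeepSupplyAtTwoNegDiscNarrow`),
on the `Δ_E > 0` branch with `ord₂ C(Wd) = 0` (`GenusPrimitiveSupplyAtTwoPosDiscShallow`).  But the genus parity law (gk2-p2 g17 / gk2-p3,
`PlusDescent.odd_padicValNat_two_tamagawaProduct_twin_of_Δ_neg`, UNCONDITIONAL: `C(E)` odd, `d_K` odd, Heegner ⟹ `(−1)^{ord₂ C(Wd)} = sign Δ_E`)
makes `ord₂ C(Wd)` ODD on `Δ_E < 0`, hence `= 1` there; and `sign Δ(Wd) = sign Δ_E` (`Δ(E^(d)) = d⁶ Δ(E)`).  So: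

* §1 **`nonCMAtTwo_of_items_of_tamagawaSlicedTwin`** — the deciding composition of the route with `hTw` REPLACED by the two cells
  `hTw0 : U₂ on (0 < Δ_W ∧ ord₂ C(W) = 0)` and `hTw1 : U₂ on (Δ_W < 0 ∧ ord₂ C(W) = 1)`; every other binder and every proof line of
  `closes` verbatim.  `minimalTwinBSDTwo_slices`: the converse bookkeeping `U₂ ⟹ hTw0 ∧ hTw1`.
* CONSEQUENCE FOR LINE 23 «twin_swap» (pen bsd-idea-1 g23, LEAD word 07:17Z: `U₂|odd-Tam ⟸ S1 + S2′ + PRINT`, S4 := `U₂|even-Tam` a declared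
  residual): the odd-Tamagawa slice of LINE 23 is EXACTLY the cell `hTw0` the `Δ > 0` branch consumes, and it serves NOTHING on the `Δ < 0`
  branch — there every consumed twin has `C(Wd)` EVEN with exactly one `2` (`hTw1`), so the route's need inside S4 is the single cell
  `(Δ < 0, ord₂ C = 1)`, not «even `C(W)`» at large (52 % of `N ≤ 250`).  On that cell the depth-zero mechanism of LINE 23 cannot work:
  Gross–Zagier over `K` reads `ord₂ #Ш_an(W_K) = 2 ord₂[E(K):ℤy_K] − 2 ord₂ C(W) − 2 ord₂ c`, so with `ord₂ C(W) = 1` BSD forces `2 ∣ y_K`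
  (kernel theorem in the sibling file `…SwappedPairHeegnerIndex`, §5) — `hTw1` is a POSITIVE-DEPTH cell, the `ε = −1` image of the supply
  cruxes' `K₄`-type cells.

References: [Kramer1981] §2 Prop. 3; [GrossZagier1986] V.§2 (2.2); [Milne1972ArithmeticAV] §1 Thm. 1; [SilvermanAEC2009] III.1 Table 3.1,
X.4.2; [Miller2011LMS] Def. 1.1.
-/

set_option autoImplicit false
set_option linter.dupNamespace false -- `Summit.<P>.<Sub>` repeats `BirchSwinnertonDyer` (D-0017)

noncomputable section

open scoped Classical

open WeierstrassCurve NumberField Literature.NumberTheory.EllipticCurves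
  Literature.NumberTheory.EllipticCurves.ModularForms
  Summit.BirchSwinnertonDyer.BirchSwinnertonDyer.Rank1Residual
  Summit.BirchSwinnertonDyer.BirchSwinnertonDyer.Theses.GenusKolyvaginAtTwo
  Summit.BirchSwinnertonDyer.BirchSwinnertonDyer.Theorems.GenusExact.PlusDescent

namespace Summit.BirchSwinnertonDyer.BirchSwinnertonDyer.Theorems.GenusExact.TwinSwap.Slices

/-! ## §0 Sign of the discriminant of a twin -/

/-- `sign Δ` of an elliptic `ℚ`-model of a quadratic twist equals `sign Δ` of the curve: `Δ(C • W^(d)) = u⁻¹² d⁶ Δ(W)`.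
[cite: SilvermanAEC2009, III.1 Table 3.1] -/
theorem Δ_twin_neg_iff (W : WeierstrassCurve ℚ) {d : ℚ} (hd : d ≠ 0) {Wd : WeierstrassCurve ℚ} (Cd : VariableChange ℚ)
    (hCd : Cd • W.quadraticTwist d = Wd) : Wd.Δ < 0 ↔ W.Δ < 0 := by
  rw [← hCd, Literature.NumberTheory.EllipticCurves.Greenberg1999.Δ_smul_neg_iff, quadraticTwist_Δ]
  have h6 : (0 : ℚ) < d ^ 6 := Even.pow_pos (by decide) hd
  constructor
  · intro h
    by_contra hW
    exact absurd h (not_lt.mpr (mul_nonneg h6.le (not_lt.mp hW)))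
  · exact fun h ↦ mul_neg_of_pos_of_neg h6 h

/-- `sign Δ` of a twin, positive side. [cite: SilvermanAEC2009, III.1 Table 3.1] -/
theorem Δ_twin_pos_iff (W : WeierstrassCurve ℚ) {d : ℚ} (hd : d ≠ 0) {Wd : WeierstrassCurve ℚ} (Cd : VariableChange ℚ)
    (hCd : Cd • W.quadraticTwist d = Wd) : 0 < Wd.Δ ↔ 0 < W.Δ := by
  rw [← hCd, Literature.NumberTheory.EllipticCurves.Greenberg1999.Δ_smul_pos_iff, quadraticTwist_Δ]
  have h6 : (0 : ℚ) < d ^ 6 := Even.pow_pos (by decide) hd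
  constructor
  · intro h
    by_contra hW
    exact absurd h (not_lt.mpr (mul_nonpos_of_nonneg_of_nonpos h6.le (not_lt.mp hW)))
  · exact fun h ↦ mul_pos h6 h

/-! ## §1 The deciding composition with the rank-one input sliced by Tamagawa valuation -/

/-- **THE ROUTE CONSUMES U₂ ON EXACTLY TWO TAMAGAWA CELLS.**  The deciding theorem `GenusKolyvaginAtTwo.closes` (rev 53) with its binder
`hTw : MinimalTwinBSDTwo` REPLACED by
`hTw0` — `BSD₂(W)` for non-CM `W` of analytic rank `1` with `#Sel₂(W) = 2`, **`0 < Δ_W` and `ord₂ C(W) = 0`** (LINE 23's odd-Tamagawa slice,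
restricted to `Δ > 0`), and
`hTw1` — the same with **`Δ_W < 0` and `ord₂ C(W) = 1`**;
all other binders (the supply cruxes, Q1, Q2, Q5R, Q3R_T, Q4_T″, the exact-descent glue, the two residuals, the four PRINT items) and every
proof line VERBATIM from `closes`.  On the `Δ_E < 0` branch the consumed twin has `ord₂ C(Wd) ≤ 1` (supply) and `ord₂ C(Wd)` odd (genus
parity `odd_padicValNat_two_tamagawaProduct_twin_of_Δ_neg`), hence `= 1`, and `Δ(Wd) < 0`; on the `Δ_E > 0` branch `ord₂ C(Wd) = 0` (supply)
and `Δ(Wd) > 0`.  CONDITIONAL on the route's items (as `closes` is); proves nothing about BSD by itself; closes no item.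
[cite: Kramer1981, §2 Prop. 3] [cite: SilvermanAEC2009, III.1 Table 3.1] [cite: Miller2011LMS, Def. 1.1] -/
theorem nonCMAtTwo_of_items_of_tamagawaSlicedTwin
    (hP : GenusPrimitiveSupplyAtTwoPosDiscShallow) (hPG : GenusDeepSupplyAtTwoNegDiscNarrow) (hQ1 : CyclicTorsionOfNegDisc)
    (hQ2 : KolyvaginRelationAtTwo)
    (hQ5R : EquivariantChebotarevAtTwoR) (hQ3RT : EquivariantKolyvaginExactAtTwoRT)
    (hQ4T : KolyvaginExactAtTwoPosDiscT) (hGf : ExactDescentAtTwoOfFourFacts)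
    (hR : OffHabitatResidualAtTwo) (hOff : OffCutResidualAtTwo)
    (hTw0 : ∀ (W : WeierstrassCurve ℚ) [W.IsElliptic] [W.IsGloballyMinimal], ¬ W.HasCM → W.analyticRank = 1 →
      Nat.card (W.selmerGroup 2) = 2 → 0 < W.Δ → padicValNat 2 W.tamagawaProduct = 0 → BSDp W 2)
    (hTw1 : ∀ (W : WeierstrassCurve ℚ) [W.IsElliptic] [W.IsGloballyMinimal], ¬ W.HasCM → W.analyticRank = 1 →
      Nat.card (W.selmerGroup 2) = 2 → W.Δ < 0 → padicValNat 2 W.tamagawaProduct = 1 → BSDp W 2)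
    (hL : EntireLFunctionRat)
    (hGZ : GrossZagierAllLevels) (hGZK : MultPublishedInputsAtTwo) (hMi : MilneAnyModel) :
    NonCMAtTwo := by
  have hG : ExactDescentAtTwo := hGf ⟨hGZ, hGZK, hL, hMi⟩
  intro W _ _ hcm hr
  haveI : NeZero (W.conductorNorm ℤ) := ⟨(W.conductorNorm_pos_holds).ne'⟩
  by_cases hH : (W.analyticRank = 0 ∧ (∀ n : ℕ, 0 < n → W.HasSurjectiveModNGaloisRep ((2 : ℤ) ^ n)) ∧
        Odd W.tamagawaProduct ∧
        ∃ Dt : Literature.NumberTheory.EllipticCurves.ModularForms.ModularParametrizationData W (W.conductorNorm ℤ),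
          (∀ z ∈ Dt.L.lattice, ∃ w ∈ Literature.NumberTheory.EllipticCurves.ModularForms.periodLattice Dt.f, z = (Dt.c : ℂ) * w) ∧ Odd Dt.c)
  · obtain ⟨hr0, hρ, hT, hopt⟩ := hH
    -- an elliptic curve has `Δ ≠ 0`
    have hΔ : W.Δ ≠ 0 := by rw [← WeierstrassCurve.coe_Δ']; exact W.Δ'.ne_zero
    -- `w(E) = +1` from `r_an(E) = 0`
    have hw : ∀ Dt : Literature.NumberTheory.EllipticCurves.ModularForms.ModularParametrizationData W (W.conductorNorm ℤ),
        W.rootNumber = 1 := fun Dt ↦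
      (Literature.Barriers.BirchSwinnertonDyer.even_analyticRank_iff_of_isNewformOf_conductorLevel Dt.isNewformOf).mp
        (by rw [hr0]; exact Even.zero)
    rcases lt_or_gt_of_ne hΔ with hneg | hpos
    · -- `Δ < 0`: the consumed twin has `Δ(Wd) < 0` and `ord₂ C(Wd) = 1`
      by_cases hmult : ∃ v : IsDedekindDomain.HeightOneSpectrum (NumberField.RingOfIntegers ℚ),
          ((2 : ℕ) : NumberField.RingOfIntegers ℚ) ∉ v.asIdeal ∧
          ((W.conductorNorm ℤ : ℕ) : NumberField.RingOfIntegers ℚ) ∈ v.asIdeal ∧ W.HasMultiplicativeReductionAt v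
      · by_cases h14 : Nat.card (W.selmerGroup 2) = 1 ∨ Nat.card (W.selmerGroup 2) = 4
        · obtain ⟨v, h2v, hNv, hmv⟩ := hmult
          obtain ⟨K, _, _, hIQ, hodd, h3, hHe, hsq1, hsq2, Dt, β, ι, d₁, hoptDt, hc, hy, M₀, hdiv, hndiv,
            n, d, hn, hKoly, hPn, Wd, _, _, hWd, hcmd, hrd, hSel, hDEF⟩ := hPG W hcm hr0 hρ hT hneg hopt h14
          have hBd : Literature.NumberTheory.EllipticCurves.BSDp Wd 2 := by
            obtain ⟨Cd, hCd⟩ := hWd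
            have hD0 : (NumberField.discr K : ℚ) ≠ 0 := by exact_mod_cast NumberField.discr_ne_zero K
            have hΔd : Wd.Δ < 0 := (Δ_twin_neg_iff W hD0 Cd hCd).mpr hneg
            obtain ⟨k, hk⟩ := odd_padicValNat_two_tamagawaProduct_twin_of_Δ_neg W hIQ hodd hHe hT hneg Cd hCd
            have h1 : padicValNat 2 Wd.tamagawaProduct = 1 := by omega
            exact hTw1 Wd hcmd hrd hSel hΔd h1
          exact hG W hcm hr0 hρ hT K hIQ hodd h3 hHe Dt hoptDt hc β ι d₁ hy M₀ hdiv hndiv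
            (hQ3RT hQ2 hQ5R hQ1 W hcm hT v h2v hNv hmv hneg K hIQ hodd h3 hHe hsq1 hsq2 hρ Dt β ι d₁ hy M₀ hdiv hndiv
              (hw Dt) Wd hWd hSel hDEF n d hn hKoly hPn)
            Wd hWd hSel hBd
        · exact hOff W hcm hr0 hρ hT hopt (Or.inr (Or.inl ⟨hneg, h14⟩))
      · exact hOff W hcm hr0 hρ hT hopt (Or.inl hmult)
    · -- `Δ > 0`: the consumed twin has `Δ(Wd) > 0` and `ord₂ C(Wd) = 0`
      by_cases hmult : ∃ v : IsDedekindDomain.HeightOneSpectrum (NumberField.RingOfIntegers ℚ),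
          ((2 : ℕ) : NumberField.RingOfIntegers ℚ) ∉ v.asIdeal ∧
          ((W.conductorNorm ℤ : ℕ) : NumberField.RingOfIntegers ℚ) ∈ v.asIdeal ∧ W.HasMultiplicativeReductionAt v
      · by_cases h14 : Nat.card (W.selmerGroup 2) = 1 ∨ (Nat.card (W.selmerGroup 2) = 4 ∧
            ∃ c ∈ (W.kummerSelmerStructure ((2 : ℕ) : ℤ)).selmerGroup,
              Literature.NumberTheory.GaloisRepresentations.galoisCohomology.localization (W.torsionGaloisModule ((2 : ℕ) : ℤ))
                (Sum.inl Rat.infinitePlace) 1 c ≠ 0)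
        · obtain ⟨v, h2v, hNv, hmv⟩ := hmult
          obtain ⟨K, _, _, hIQ, hodd, h3, hHe, hsq1, hsq2, Dt, β, ι, d₁, hoptDt, hc, hy, M₀, hdiv, hndiv,
            n, d, hn, hKoly, hPn, Wd, _, _, hWd, hcmd, hrd, hSel, hTam⟩ := hP W hcm hr0 hρ hT hpos hopt h14
          have hBd : Literature.NumberTheory.EllipticCurves.BSDp Wd 2 := by
            obtain ⟨Cd, hCd⟩ := hWd
            have hD0 : (NumberField.discr K : ℚ) ≠ 0 := by exact_mod_cast NumberField.discr_ne_zero K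
            have hΔd : 0 < Wd.Δ := (Δ_twin_pos_iff W hD0 Cd hCd).mpr hpos
            exact hTw0 Wd hcmd hrd hSel hΔd hTam
          exact hG W hcm hr0 hρ hT K hIQ hodd h3 hHe Dt hoptDt hc β ι d₁ hy M₀ hdiv hndiv
            (hQ4T hQ2 W hcm hT v h2v hNv hmv hpos K hIQ hodd h3 hHe hsq1 hsq2 hρ Dt β ι d₁ hy M₀ hdiv hndiv (hw Dt) Wd hWd hSel hTam
              n d hn hKoly hPn)
            Wd hWd hSel hBd
        · exact hOff W hcm hr0 hρ hT hopt (Or.inr (Or.inr ⟨hpos, h14⟩))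
      · exact hOff W hcm hr0 hρ hT hopt (Or.inl hmult)
  · exact hR W hcm hr hH

/-- **Converse bookkeeping**: U₂ (`MinimalTwinBSDTwo`) implies both cells `hTw0`, `hTw1` (the extra binders are idle).  With §1: for the
purpose of `closes`, U₂ may be replaced by the pair of cells without loss.  [cite: Miller2011LMS, Def. 1.1] -/
theorem minimalTwinBSDTwo_slices (hTw : MinimalTwinBSDTwo) :
    (∀ (W : WeierstrassCurve ℚ) [W.IsElliptic] [W.IsGloballyMinimal], ¬ W.HasCM → W.analyticRank = 1 →
      Nat.card (W.selmerGroup 2) = 2 → 0 < W.Δ → padicValNat 2 W.tamagawaProduct = 0 → BSDp W 2) ∧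
    (∀ (W : WeierstrassCurve ℚ) [W.IsElliptic] [W.IsGloballyMinimal], ¬ W.HasCM → W.analyticRank = 1 →
      Nat.card (W.selmerGroup 2) = 2 → W.Δ < 0 → padicValNat 2 W.tamagawaProduct = 1 → BSDp W 2) :=
  ⟨fun W _ _ hcm hr hSel _ _ ↦ hTw W hcm hr hSel, fun W _ _ hcm hr hSel _ _ ↦ hTw W hcm hr hSel⟩

end Summit.BirchSwinnertonDyer.BirchSwinnertonDyer.Theorems.GenusExact.TwinSwap.Slices

end
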